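import Summits.Schanuel.Schanuel.Theorems.RootDecomp1KLevelFinite12

/-!
# RootDecomp1KLevelFinite — lens 1, generation 51 ADDENDUM-4 «THE x-LACUNARY DEGREE LADDER» (RECORD port, ×0) — continuation (RootDecomp1KLevelFinite13): §11.4–§11.6 the general x-gap, members decided at m₀ = 2, erratum

(lens-1 g51 ADDENDUM-4 kernel L = HOME/decomp-schanuel-lens-1/g51/LacunaryLadder.lean c9f66605…, 561 l, 38 thm + 4 def, imports tree …RootDecomp1KLevelFinite09 + …RootDecomp1KXAll03 ONLY; Probe f00afc14… rc 0 (51 axiom guards) / Ctrl0 1408ccaf… rc 0 / Ctrl 5d11fea4… rc 1 = 12 planted; memo NODE-g51-ADDENDUM4.md 1dbff05a…; CLAIM L2518, crit EX-ANTE PRICE L2519 ×0-AS-RECORD under K-R36 (i) / K-R40 (viii) (threshold function refined by the x-support on a sub-family; record port welcome), ADDENDUM-4/NODE L2520 — critic VERIFIED OF RECORD + PORT GO L2522 (MOD: rename `cuspP` → `cuspTwoTermP`, homonym of the tree's `RootDecomp1KXLinear.cuspP`); lens-1 g51 DONE L2523. RECORD port by census-1 gen 21 as `RootDecomp1KLevelFinite12–13`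 (×0, no credit anywhere): 12 = §11.1 `gap_tail` + §11.2 `pow_dvd_coeff_of_root_gap` (Gauss through an x-gap: a rational root p/D of Q ∈ ℤ[x] with no support in (K−γ, K) forces D^γ ∣ Q_K) + §11.3 two-term curves `twoTermP k B A` = x^k·B(Y) − A(Y) with **`thinFibreAt_twoTermP : 1 ≤ k → natDegree < k·m₀ → ThinFibreAt m₀ (twoTermP k B A)`** for ALL B, A; 13 = §11.4 the general x-gap `thinFibreAt_xPolyP_gap` + §11.5 members decided at every m₀ ≥ 2 inside the K-R40 (viii) territory (`ellP` = x²(Y³ − 25Y) − 1, `cuspTwoTermP` (K: `cuspP`, RENAMED at port — homonym of tree `RootDecomp1KXLinear.cuspP` = X³ − C X², sanctioned L2522) = x²(Y−1)²(Y+2) − 1, `quartP` = x³(Y⁴+Y) − 2; `thinFibreAt_ellP` / `thinFibreAt_cuspTwoTermP` / `thinFibreAt_quartP`, position lemmas incl. `not_xLinearLt_ellP`, `exists_padic_root_top_…`) + §11.6 erratum in passing (the line (x − 1)·Y = 1 at quality 2). PORT EDITS: the sanctioned RENAME `cuspP` → `cuspTwoTermP` (with `bev_` / `natDegree_` / `thinFibreAt_`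 … lemmas following); 10 one-line docstrings added on the §11.5 computation lemmas (statements quoted); `section LacunaryLadder` closed in 12 and re-opened in 13; statements and proofs otherwise verbatim (K has no set_option / private / «[cite» token). `--supports stmt-Schanuel-33364`; rung 0 — nothing here proves Schanuel, 33364, 31077 or ThinFibre m₀ hypothesis-free.)
-/

noncomputable section

open Polynomial LiouvilleNumber
open scoped Nat
namespace Summit.Schanuel.Schanuel.Theorems.RootDecomp1KLevelFinite

open Summit.Schanuel.Schanuel.Theorems.RootDecomp1KTwoBaseCell (psNumer partialSum_eq_psNumer_div coprime_psNumer)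
open Summit.Schanuel.Schanuel.Theorems.RootDecomp1KRelLiouvilleCell (partialSum_two_lt_liouvilleNumber
  liouvilleNumber_two_lt partialSum_two_zero)
open Summit.Schanuel.Schanuel.Theorems.RootDecomp1KDegreeLadder
open Summit.Schanuel.Schanuel.Theorems.RootDecomp1KXLinear (xLinP bev_xLinP bev_map_C XLinearLt aeval_ratCast)
open Summit.Schanuel.Schanuel.Theorems.RootDecomp1KXTop (xPolyP bev_xPolyP)
open Summit.Schanuel.Schanuel.Theorems.RootDecomp1KXAll (thinThreshold coeff_coeff_xPolyP)

section LacunaryLadder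

/-! ### §11.4  The general `x`-gap: `P = Σ_{j ≤ k} x^j c_j(Y)` with `c_j = 0` for `k − γ < j < k` and a top
`c_k` without rational roots -/

/-- the cleared specialisation of `xPolyP k c` at `Y = r` has no `x`-monomial of exponent `i` whenever `c_i = 0`
or `i > k`. -/
theorem coeff_specX_xPolyP_eq_zero (k : ℕ) (c : ℕ → ℤ[X]) (r : ℚ) {i : ℕ} (hi : k < i ∨ c i = 0) :
    (specX (xPolyP k c) r).coeff i = 0 := by
  rw [coeff_specX]
  refine Finset.sum_eq_zero fun j _ => ?_
  rw [coeff_coeff_xPolyP]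
  rcases hi with hi | hi
  · rw [if_neg (by simp; omega), zero_mul]
  · split_ifs
    · rw [hi, coeff_zero, zero_mul]
    · rw [zero_mul]

/-- the top `x`-coefficient of the cleared specialisation is the cleared value `den(r)^d · c_k(r)`. -/
theorem coeff_specX_xPolyP_top (k : ℕ) (c : ℕ → ℤ[X]) (r : ℚ) :
    (specX (xPolyP k c) r).coeff k = clearedEval (c k) r.num r.den (xPolyP k c).natDegree := by
  rw [coeff_specX, clearedEval]
  refine Finset.sum_congr rfl fun j _ => ?_
  rw [coeff_coeff_xPolyP, if_pos (by simp), mul_assoc]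

/-- the `Y`-degree of `c_k` is at most the `Y`-degree of `xPolyP k c`. -/
theorem natDegree_top_le_natDegree_xPolyP (k : ℕ) (c : ℕ → ℤ[X]) :
    (c k).natDegree ≤ (xPolyP k c).natDegree := by
  refine (natDegree_le_iff_coeff_eq_zero).mpr fun j hj => ?_
  have h := coeff_coeff_xPolyP k c j k
  rw [coeff_eq_zero_of_natDegree_lt hj, coeff_zero, if_pos (by simp)] at h
  exact h.symm

/-- **THE x-LACUNARY DEGREE LADDER, general form** (hypothesis-free).  Let `P = Σ_{j ≤ k} x^j·c_j(Y)` have NO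
`x`-monomials of exponent strictly between `k − γ` and `k` (`1 ≤ γ ≤ k`) and a top `x`-coefficient `c_k` WITHOUT
RATIONAL ROOTS.  Then `ThinFibreAt m₀ P` for every `m₀` with `deg_Y P < γ·m₀`.  (Gauss through the gap on
`specX P r`, whose top coefficient `den(r)^d·c_k(r)` is non-zero; `γ = 1` is the tree's degree ladder.  Tops WITH
rational roots: the two-term theorem `thinFibreAt_twoTermP` needs no such proviso.) -/
theorem thinFibreAt_xPolyP_gap (k γ : ℕ) (c : ℕ → ℤ[X]) (hγ : 1 ≤ γ) (hγk : γ ≤ k)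
    (hgap : ∀ j, k - γ < j → j < k → c j = 0) (htop : ∀ t : ℚ, aeval t (c k) ≠ 0) {m₀ : ℕ}
    (hm : (xPolyP k c).natDegree < γ * m₀) : ThinFibreAt m₀ (xPolyP k c) := by
  classical
  intro C
  set P := xPolyP k c with hPdef
  obtain ⟨C₃, hC₃0, hC₃⟩ := coeff_specX_bound_abs P (max C 1) (le_max_right _ _)
  obtain ⟨N₁, hN₁⟩ := gap_tail C C₃ hC₃0 hγ hm
  refine ⟨max N₁ 2, fun N hN r hrC hA hx => ?_⟩
  have hN2 : 2 ≤ N := le_trans (le_max_right _ _) hN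
  have hNN₁ : N₁ ≤ N := le_trans (le_max_left _ _) hN
  set Q := specX P r with hQ
  have hdegQ : Q.natDegree ≤ k :=
    (natDegree_le_iff_coeff_eq_zero).mpr fun i hi => coeff_specX_xPolyP_eq_zero k c r (Or.inl hi)
  -- the root `s_N = p_N / 2^{N!}` in lowest terms
  have hsNfrac : partialSum 2 N = (((psNumer 2 N : ℕ) : ℤ) : ℝ) / ((2 ^ N ! : ℕ) : ℝ) := by
    rw [lac_partialSum_two]; push_cast; rfl
  have hcop : IsCoprime (((2 ^ N ! : ℕ) : ℤ)) (((psNumer 2 N : ℕ) : ℤ)) :=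
    Nat.isCoprime_iff_coprime.mpr (coprime_psNumer_two_pow hN2 (N !))
  have hrootN : aeval ((((psNumer 2 N : ℕ) : ℤ) : ℝ) / ((2 ^ N ! : ℕ) : ℝ)) Q = 0 := by
    rw [← hsNfrac, hQ, aeval_specX, hA, mul_zero]
  -- Gauss through the gap: `(2^{N!})^γ ∣ Q_k`
  have hdvd : (((2 ^ N ! : ℕ) : ℤ)) ^ γ ∣ Q.coeff k :=
    pow_dvd_coeff_of_root_gap Q (by positivity) hcop hγk hdegQ
      (fun i h1 h2 => coeff_specX_xPolyP_eq_zero k c r (Or.inr (hgap i h1 h2))) hrootN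
  -- `Q_k = den(r)^d · c_k(r) ≠ 0`
  have hqk : Q.coeff k ≠ 0 := by
    rw [hQ, coeff_specX_xPolyP_top]
    intro h0
    have hc := clearedEval_cast (c k) r.num r.den_pos (natDegree_top_le_natDegree_xPolyP k c)
    rw [h0, Int.cast_zero] at hc
    have hden : (0 : ℝ) < (r.den : ℝ) ^ (xPolyP k c).natDegree := by positivity
    have er : ((r.num : ℤ) : ℝ) / (r.den : ℝ) = ((r : ℚ) : ℝ) := by rw [Rat.cast_def]
    rw [er, ← aeval_ratCast] at hc
    rcases mul_eq_zero.mp hc.symm with h | h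
    · exact absurd h hden.ne'
    · exact htop r (by exact_mod_cast h)
  -- the forced height
  have hG : (((2 ^ N ! : ℕ) : ℤ)) ^ γ ≤ |Q.coeff k| :=
    Int.le_of_dvd (abs_pos.mpr hqk) ((dvd_abs _ _).mpr hdvd)
  have hV : (2 : ℝ) ^ (γ * N !) ≤ C₃ * (r.den : ℝ) ^ P.natDegree := by
    have h1 : (((((2 ^ N ! : ℕ) : ℤ)) ^ γ : ℤ) : ℝ) ≤ ((|Q.coeff k| : ℤ) : ℝ) := by exact_mod_cast hG
    have h2 : ((|Q.coeff k| : ℤ) : ℝ) ≤ C₃ * (r.den : ℝ) ^ P.natDegree := by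
      rw [Int.cast_abs]; exact hC₃ r (hrC.trans (le_max_left _ _)) k
    have h3 : (((((2 ^ N ! : ℕ) : ℤ)) ^ γ : ℤ) : ℝ) = (2 : ℝ) ^ (γ * N !) := by
      push_cast; rw [← pow_mul, mul_comm]
    linarith
  exact hN₁ N hNN₁ r.den r.den_pos hV

/-! ### §11.5  Members inside the open territory of record, decided at `m₀ = 2`

All three have `x`-degree `≥ 2`, `Y`-degree `≥ 2` and a top `x`-coefficient WITH roots in `ℚ ⊂ ℚ₂`. -/

/-- the ELLIPTIC MEMBER `ellP = x²·(Y³ − 25Y) − 1`, i.e. the curve `W² = Y³ − 25Y` (the congruent-number curve of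
`5`, rank one) in the coordinate `x = 1/W`. -/
def ellP : ℤ[X][X] := twoTermP 2 (X ^ 3 - Polynomial.C 25 * X) 1

/-- the NON-SEPARABLE-TOP MEMBER `cuspTwoTermP = x²·(Y − 1)²(Y + 2) − 1` (top with the double root `1`: `μ = 2`). -/
def cuspTwoTermP : ℤ[X][X] := twoTermP 2 ((X - 1) ^ 2 * (X + 2)) 1

/-- the `x`-CUBIC MEMBER `quartP = x³·(Y⁴ + Y) − 2`. -/
def quartP : ℤ[X][X] := twoTermP 3 (X ^ 4 + X) (Polynomial.C 2)

/-- `(x y : ℝ) : bev ellP x y = x ^ 2 * (y ^ 3 - 25 * y) - 1`. -/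
theorem bev_ellP (x y : ℝ) : bev ellP x y = x ^ 2 * (y ^ 3 - 25 * y) - 1 := by
  rw [ellP, bev_twoTermP]; simp [map_ofNat]

/-- `(x y : ℝ) : bev cuspTwoTermP x y = x ^ 2 * ((y - 1) ^ 2 * (y + 2)) - 1`. -/
theorem bev_cuspTwoTermP (x y : ℝ) : bev cuspTwoTermP x y = x ^ 2 * ((y - 1) ^ 2 * (y + 2)) - 1 := by
  rw [cuspTwoTermP, bev_twoTermP]; simp [map_ofNat]

/-- `(x y : ℝ) : bev quartP x y = x ^ 3 * (y ^ 4 + y) - 2`. -/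
theorem bev_quartP (x y : ℝ) : bev quartP x y = x ^ 3 * (y ^ 4 + y) - 2 := by
  rw [quartP, bev_twoTermP]; simp [map_ofNat]

/-- `(X ^ 3 - Polynomial.C 25 * X : ℤ[X]).natDegree = 3`. -/
theorem natDegree_ellB : (X ^ 3 - Polynomial.C 25 * X : ℤ[X]).natDegree = 3 := by compute_degree!

/-- `((X - 1) ^ 2 * (X + 2) : ℤ[X]).natDegree = 3`. -/
theorem natDegree_cuspB : ((X - 1) ^ 2 * (X + 2) : ℤ[X]).natDegree = 3 := by
  have : ((X - 1) ^ 2 * (X + 2) : ℤ[X]) = X ^ 3 - Polynomial.C 3 * X + Polynomial.C 2 := by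
    simp only [map_ofNat]; ring
  rw [this]; compute_degree!

/-- `(X ^ 4 + X : ℤ[X]).natDegree = 4`. -/
theorem natDegree_quartB : (X ^ 4 + X : ℤ[X]).natDegree = 4 := by compute_degree!

/-- `ellP.natDegree = 3`. -/
theorem natDegree_ellP : ellP.natDegree = 3 := by
  rw [ellP, natDegree_twoTermP, natDegree_ellB]
  · intro h; have := natDegree_ellB; rw [h, natDegree_zero] at this; exact absurd this (by norm_num)
  · rw [natDegree_one, natDegree_ellB]; norm_num

/-- `cuspTwoTermP.natDegree = 3`. -/
theorem natDegree_cuspTwoTermP : cuspTwoTermP.natDegree = 3 := by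
  rw [cuspTwoTermP, natDegree_twoTermP, natDegree_cuspB]
  · intro h; have := natDegree_cuspB; rw [h, natDegree_zero] at this; exact absurd this (by norm_num)
  · rw [natDegree_one, natDegree_cuspB]; norm_num

/-- `quartP.natDegree = 4`. -/
theorem natDegree_quartP : quartP.natDegree = 4 := by
  rw [quartP, natDegree_twoTermP, natDegree_quartB]
  · intro h; have := natDegree_quartB; rw [h, natDegree_zero] at this; exact absurd this (by norm_num)
  · rw [natDegree_C, natDegree_quartB]; norm_num

/-- **the elliptic member is decided at every `m₀ ≥ 2`** (`deg_Y = 3 < 2·2`). -/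
theorem thinFibreAt_ellP {m₀ : ℕ} (hm : 2 ≤ m₀) : ThinFibreAt m₀ ellP := by
  apply thinFibreAt_twoTermP (k := 2) (by norm_num)
  have h : (twoTermP 2 (X ^ 3 - Polynomial.C 25 * X) 1).natDegree = 3 := natDegree_ellP
  omega

/-- **the non-separable-top member is decided at every `m₀ ≥ 2`** (`deg_Y = 3 < 2·2`). -/
theorem thinFibreAt_cuspTwoTermP {m₀ : ℕ} (hm : 2 ≤ m₀) : ThinFibreAt m₀ cuspTwoTermP := by
  apply thinFibreAt_twoTermP (k := 2) (by norm_num)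
  have h : (twoTermP 2 ((X - 1) ^ 2 * (X + 2)) 1).natDegree = 3 := natDegree_cuspTwoTermP
  omega

/-- **the `x`-cubic member is decided at every `m₀ ≥ 2`** (`deg_Y = 4 < 3·2`). -/
theorem thinFibreAt_quartP {m₀ : ℕ} (hm : 2 ≤ m₀) : ThinFibreAt m₀ quartP := by
  apply thinFibreAt_twoTermP (k := 3) (by norm_num)
  have h : (twoTermP 3 (X ^ 4 + X) (Polynomial.C 2)).natDegree = 4 := natDegree_quartP
  omega

/-! Position of the elliptic member with respect to the tree-decided classes at `m₀ = 2`. -/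

/-- `deg_Y ellP = 3 ≥ 2`: the degree ladder `thinFibreAt_of_natDegree_lt` needs `m₀ ≥ 4`. -/
theorem two_le_natDegree_ellP : 2 ≤ ellP.natDegree := by rw [natDegree_ellP]; norm_num

/-- `ellP` has NO x-linear presentation at all (`x`-degree 2): neither node 2's `XLinearLt` nor the separable
x-linear class of `RootDecomp1KXLinearII` contains it. -/
theorem ellP_ne_xLinP (A B : ℤ[X]) : ellP ≠ xLinP A B := by
  intro hP
  have h := fun x : ℝ => congrArg (fun Q => bev Q x 1) hP
  simp only [bev_ellP, bev_xLinP] at h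
  have h0 := h 0
  have h1 := h 1
  have h2 := h 2
  norm_num at h0 h1 h2
  linarith

/-- `¬ XLinearLt ellP`. -/
theorem not_xLinearLt_ellP : ¬ XLinearLt ellP := fun ⟨A, B, _, _, hP⟩ => ellP_ne_xLinP A B hP

/-- the tree's threshold `thinThreshold ellP = max(3, …) ≥ 3`: `RootDecomp1KXAll.thinFibreAt_all` does not reach
`m₀ = 2` (for any curve). -/
theorem three_le_thinThreshold_ellP : 3 ≤ thinThreshold ellP := le_max_left _ _

/-- in EVERY presentation `ellP = Σ_{j ≤ k} x^j c_j(Y)` the top `x`-coefficient `c_k` HAS A ROOT in `ℚ₂` (it is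
`Y³ − 25Y`, with the roots `0, ±5`, or zero): the 2-adically-rootless-top class of ADDENDUM-3 does not contain
`ellP` — its near-root branch is LIVE. -/
theorem exists_padic_root_top_of_ellP_eq (k : ℕ) (c : ℕ → ℤ[X]) (h : ellP = xPolyP k c) :
    ∃ z : ℚ_[2], aeval z (c k) = 0 := by
  have hc : ∀ i j : ℕ, ((if j = 2 then (X ^ 3 - Polynomial.C 25 * X : ℤ[X]).coeff i else 0) -
      (if j = 0 then (1 : ℤ[X]).coeff i else 0)) = (if j ∈ Finset.range (k + 1) then (c j).coeff i else 0) := by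
    intro i j
    rw [← coeff_coeff_twoTermP 2, ← coeff_coeff_xPolyP, ← h]; rfl
  rcases lt_trichotomy k 2 with hk | rfl | hk
  · exfalso
    have h32 := hc 3 2
    rw [if_pos rfl, if_neg (by norm_num), if_neg (by simp; omega)] at h32
    simp [coeff_X] at h32
  · refine ⟨0, ?_⟩
    have hc2 : c 2 = X ^ 3 - Polynomial.C 25 * X := by
      ext i
      have := hc i 2
      rw [if_pos rfl, if_neg (by norm_num), if_pos (by simp), sub_zero] at this
      exact this.symm
    rw [hc2]; simp
  · refine ⟨0, ?_⟩
    have hck : c k = 0 := by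
      ext i
      have := hc i k
      rw [if_neg (by omega), if_neg (by omega), if_pos (by simp), sub_zero] at this
      rw [coeff_zero]; exact this.symm
    rw [hck, map_zero]

/-- a rational point of the elliptic member: `(x, Y) = (1/6, −4)` (`6² = (−4)³ − 25·(−4)`); `W² = Y³ − 25Y` has rank
one, so there are infinitely many — the clause of `ellP` is not vacuous for global reasons. -/
theorem ratPoint_ellP : bev ellP (1 / 6) (-4) = 0 := by rw [bev_ellP]; norm_num

/-- a rational point of the non-separable-top member: `(x, Y) = (1/2, 2)`. -/
theorem ratPoint_cuspTwoTermP : bev cuspTwoTermP (1 / 2) 2 = 0 := by rw [bev_cuspTwoTermP]; norm_num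

/-- a rational point of the `x`-cubic member: `(x, Y) = (1, 1)`. -/
theorem ratPoint_quartP : bev quartP 1 1 = 0 := by rw [bev_quartP]; norm_num

/-- the fibre of the elliptic member over `x = ℓ₂` HAS a real point (`P(ℓ₂, 0) = −1 < 0 < P(ℓ₂, 6) = 66ℓ₂² − 1`):
its clause is not vacuous for archimedean reasons either. -/
theorem exists_real_fibre_point_ellP : ∃ y : ℝ, bev ellP (liouvilleNumber 2) y = 0 := by
  have h1 : 1 < liouvilleNumber 2 := by
    have h := partialSum_two_lt_liouvilleNumber 1
    have e : partialSum 2 1 = 1 := by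
      rw [partialSum_succ, partialSum_two_zero]
      norm_num
    linarith
  set ℓ : ℝ := liouvilleNumber 2 with hℓ
  let f : ℝ → ℝ := fun y => ℓ ^ 2 * (y ^ 3 - 25 * y) - 1
  have hf : ContinuousOn f (Set.Icc 0 6) := by
    apply Continuous.continuousOn
    fun_prop
  have ha : f 0 < 0 := by
    show ℓ ^ 2 * ((0 : ℝ) ^ 3 - 25 * 0) - 1 < 0
    norm_num
  have hb : 0 < f 6 := by
    show 0 < ℓ ^ 2 * ((6 : ℝ) ^ 3 - 25 * 6) - 1
    nlinarith
  obtain ⟨y, -, hy⟩ := intermediate_value_Icc (show (0 : ℝ) ≤ 6 by norm_num) hf ⟨ha.le, hb.le⟩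
  exact ⟨y, by rw [bev_ellP]; exact hy⟩

/-! ### §11.6  Erratum in passing: the line `(x − 1)·Y = 1` at quality `2` -/

/-- `ThinFibreAt 2 lineP` HOLDS — by the tree's degree ladder, since `deg_Y lineP = 1 < 2` (the docstring of
`RootDecomp1KXLinearII.thinFibreAt_lineP` calling `m₀ = 2` for the line «Roth-critical, open» is an erratum: the
degree ladder decides every curve of `Y`-degree `1` at `m₀ = 2`). -/
theorem thinFibreAt_two_lineP : ThinFibreAt 2 lineP :=
  thinFibreAt_of_natDegree_lt (lt_of_le_of_lt natDegree_lineP_le one_lt_two)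

/-- … indeed at every `m₀ ≥ 2` (and NOT at `m₀ = 1`: tree `not_thinFibre_one`). -/
theorem thinFibreAt_lineP_of_two_le {m₀ : ℕ} (hm : 2 ≤ m₀) : ThinFibreAt m₀ lineP :=
  thinFibreAt_of_natDegree_lt (lt_of_le_of_lt natDegree_lineP_le (lt_of_lt_of_le one_lt_two hm))

end LacunaryLadder

end Summit.Schanuel.Schanuel.Theorems.RootDecomp1KLevelFinite

end
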